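/-
Copyright (c) 2026 the pub-hodgecm-mathlib formalisation cell (harness21).  Prover seat hodgecm-mathlib-LH4-p08 (g0), Track A «(D-RAM) FOUR-FRAME», second seat on
U3 `stub_U3_stableLaw_RP` (brick «GL₃ CONDUCTOR-SQUARE COUNT» from LH4-p10 (g0), steps (D1)(D2) of the split 22:23Z): EXISTENCE and EQUALITY CRITERION of the
lower-triangular HNF of a lattice of `K³` inside `𝒪³` with a unit first coordinate.  2026-09-03.
-/
import Summits.HodgeConjecture.HodgeConjecture.Theorems.F0P3cDyRamDiagonalStableLatticeHNF   -- ★ (this seat, FILE 1): `mem_latt_hnf_iff`, `mulVec_hnf`, `latt_hnf_le_stdLattice`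
import Literature.NumberTheory.Automorphic.UnitaryLatticeTreeIsTree                         -- ★ `exists_scaleLattice_pow_stdLattice_le_latt` (a full lattice contains some `ϖ^j𝒪³`)
import Literature.NumberTheory.Automorphic.UnitaryThreeFourFrameRankTwoShape                -- ★ `exists_mul_of_v_le` (`|x| ≤ |y| ⇒ x = r·y`, `r ∈ 𝒪`)
import Literature.NumberTheory.Automorphic.UnitaryLatticeTreeIsocelesRegionCriterionRamified -- ★ `smul_mem_of_v_le_one` (reused, dedup)
import HarnessLib

/-!
# (D-RAM) «FOUR-FRAME» road, unit U3 (iii), TIER 2 SUPPORT toward (S) by the finite-ring route (S-fin): EVERY LATTICE OF `K³` INSIDE `𝒪³` WITH A UNIT FIRST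
# COORDINATE HAS A LOWER-TRIANGULAR HNF `V·𝒪³`, `V = [[1,0,0],[x,ϖ^b,0],[y,z,ϖ^c]]`, AND TWO HNF MODELS SPAN THE SAME LATTICE iff FIVE VALUATION INEQUALITIES HOLD

Cell `pub/hodgecm-mathlib` (D-0151), crux H413 = `stmt-HodgeConjecture-24833` (lane `--supports … --as helper`, count-neutral), route HCCMUnconditional; tier-1 socket
`Cruxes/H413/Lines/F0_P3c_DyRamFourFrame_U3_Laws.lean`, stubs `stub_U3_stableLaw_RP ∕ _RU`.  Sequel of ★ FILE 1 `F0P3cDyRamDiagonalStableLatticeHNF` (the HNF MODEL: membership,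
`diag(s)`-stability, normalisation in closed form): the ENUMERATION half of LH4-p10's conductor-square count `#𝓛₀ = q^{n₀₁+n₀₂+n₁₂}` — (D1) every normalised lattice IS an
HNF model, (D2) when two models coincide — so that the count of (S-fin) step (3) runs over the parameters `(b, c, x mod 𝔭^b, y, z mod 𝔭^c)` (LH4-p10's strata).

* §1 `latt_le_iff_columns` (a lattice `V·𝒪ᴺ` lies in a submodule iff the columns of `V` do), `single_pow_mem_of_scaleLattice_le` (★ `smul_mem_of_v_le_one` reused).
* §2 **(D1) `exists_latt_eq_latt_hnf`**: for `|ϖ| = exp(−1)`, `g ∈ GL₃(K)` with `g·𝒪³ ≤ 𝒪³` and some `w ∈ g·𝒪³` with `|w₀| = 1`, there are `b c : ℕ` and integral `x y z`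
  with `g·𝒪³ = V(x,y,z,ϖ^b,ϖ^c)·𝒪³`.  (`c`, `b` = the least exponents with `ϖ^c e₂ ∈ M`, `(0, ϖ^b, t) ∈ M` — `Nat.find` over ★ `exists_scaleLattice_pow_stdLattice_le_latt`;
  `(1, x, y) = w₀⁻¹·w`; the filtration argument `w′ − w′₀(1,x,y) − λ(0,ϖ^b,z) ∈ 𝒪·ϖ^c e₂` read through ★ `mem_latt_hnf_iff`.)
* §3 **(D2) `latt_hnf_le_latt_hnf_iff`**, **`latt_hnf_eq_latt_hnf_iff`**: `V(x,y,z,p,r)·𝒪³ = V(x′,y′,z′,p′,r′)·𝒪³ ↔ |p| = |p′| ∧ |r| = |r′| ∧ |x − x′| ≤ |p| ∧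
  |z·p′ − z′·p| ≤ |p·r| ∧ |(y − y′)·p′ − z′·(x − x′)| ≤ |p·r|` (columns through ★ `mem_latt_hnf_iff`, both ways).

HONEST LABEL: HC_CM is proved only modulo the 7 printed citations (2 remaining named inputs: hLiu418 = stmt-HodgeConjecture-24832, h413 = stmt-HodgeConjecture-24833) until rung 0
closes; generic valued-field lattice algebra, count-neutral; the census law (S) stays a PROVER TARGET.

## References
* [Serre1980Trees] J.-P. Serre, *Trees*, Springer (1980), Ch. II §1.1 (lattices, Hermite normal form relative to a flag).
* [Kottwitz1986BaseChangeUnits] R. E. Kottwitz, *Base change for unit elements of Hecke algebras*, Compositio Math. 60 (1986), §1 pp. 240–241.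
* [Laumon1995] G. Laumon, *Cohomology of Drinfeld Modular Varieties I* (1996), Lemma (5.3.2) p. 136 (triangular decomposition of lattice counts).
-/

set_option autoImplicit false

noncomputable section

namespace Summit.HodgeConjecture.HodgeConjecture.Cruxes.H413.F0P3cDyRamDiagonalStableLatticeHNFExists

open Matrix
open Literature.NumberTheory.Automorphic Literature.NumberTheory.Automorphic.HermitianLattice
open Literature.NumberTheory.Automorphic.UnitaryLatticeTree Literature.NumberTheory.Automorphic.UnitaryThreeFourFrame
open Summit.HodgeConjecture.HodgeConjecture.Cruxes.H413.F0P3cDyRamDiagonalStableLatticeHNF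
open Literature.NumberTheory.Automorphic.CartanUnique (uniformizer_ne_zero)
open scoped Valued WithZero Matrix MatrixGroups

variable {K : Type*} [Field K] [Valued K ℤᵐ⁰]

/-! ## §1  Bookkeeping -/

/-- A lattice `V·𝒪ᴺ` lies in a submodule `M` iff the columns of `V` do. [cite: Serre1980Trees, Ch. II §1.1] -/
theorem latt_le_iff_columns {N : ℕ} (V : Matrix (Fin N) (Fin N) K) (M : Submodule 𝒪[K] (Fin N → K)) :
    latt V ≤ M ↔ ∀ j, V *ᵥ (Pi.single j 1) ∈ M := by
  constructor
  · exact fun h j => h (mulVec_single_mem_latt V j)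
  · intro h w hw
    obtain ⟨u, hu, rfl⟩ := Submodule.mem_map.1 hw
    rw [LinearMap.restrictScalars_apply, Matrix.toLin'_apply]
    have hexp : V *ᵥ u = ∑ j, u j • (V *ᵥ (Pi.single j 1)) := by
      conv_lhs => rw [show u = ∑ j, u j • (Pi.single j (1 : K) : Fin N → K) from by
        ext k; simp [Finset.sum_apply, Pi.single_apply]]
      rw [Matrix.mulVec_sum]
      refine Finset.sum_congr rfl fun j _ => ?_
      rw [Matrix.mulVec_smul]
    rw [hexp]
    exact Submodule.sum_mem _ fun j _ => M.smul_mem (⟨u j, (mem_stdLattice.1 hu) j⟩ : 𝒪[K]) (h j)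

/-- `V·𝒪³ ≤ M` from the three columns (rank-`3` form of `latt_le_iff_columns`, with literal slots). [cite: Serre1980Trees, Ch. II §1.1] -/
theorem latt_le_of_columns_three (V : Matrix (Fin 3) (Fin 3) K) (M : Submodule 𝒪[K] (Fin 3 → K))
    (h0 : V *ᵥ (Pi.single 0 1) ∈ M) (h1 : V *ᵥ (Pi.single 1 1) ∈ M) (h2 : V *ᵥ (Pi.single 2 1) ∈ M) : latt V ≤ M := by
  rw [latt_le_iff_columns]
  intro j
  fin_cases j
  · exact h0
  · exact h1
  · exact h2

/-- If `ϖ^j·𝒪ᴺ ≤ M` then `ϖ^j·e_i ∈ M`. [cite: Serre1980Trees, Ch. II §1.1] -/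
theorem single_pow_mem_of_scaleLattice_le {N : ℕ} {ϖ : K} (hϖ0 : ϖ ≠ 0) {j : ℕ} {M : Submodule 𝒪[K] (Fin N → K)}
    (h : scaleLattice (ϖ ^ j) (stdLattice K N) ≤ M) (i : Fin N) : (Pi.single i (ϖ ^ j) : Fin N → K) ∈ M := by
  refine h ((mem_scaleLattice_stdLattice_iff (pow_ne_zero _ hϖ0) _).2 fun k => ?_)
  by_cases hk : k = i
  · subst hk; rw [Pi.single_eq_same]
  · rw [Pi.single_eq_of_ne hk, map_zero]; exact zero_le

/-- In a discretely valued field with `|ϖ| = exp(−1)`, a non-zero `t` with `|t| ≤ 1` is `ϖ^n` times a unit: `|t| = |ϖ^n|` and `ϖ^n = (ϖ^n t⁻¹)·t` with `|ϖ^n t⁻¹| = 1`.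
[cite: Serre1980Trees, Ch. II §1.1] -/
theorem exists_pow_v_eq {ϖ : K} (hϖ : Valued.v ϖ = WithZero.exp (-1 : ℤ)) {t : K} (ht0 : t ≠ 0) (ht : Valued.v t ≤ 1) :
    ∃ n : ℕ, Valued.v t = Valued.v (ϖ ^ n) := by
  have hvt : Valued.v t ≠ 0 := (Valuation.ne_zero_iff _).2 ht0
  obtain ⟨k, hk⟩ : ∃ k : ℤ, Valued.v t = WithZero.exp k := ⟨_, (WithZero.exp_log hvt).symm⟩
  have hk0 : k ≤ 0 := by rw [hk, ← WithZero.exp_zero, WithZero.exp_le_exp] at ht; exact ht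
  refine ⟨(-k).toNat, ?_⟩
  rw [hk, map_pow, hϖ, ← WithZero.exp_nsmul, nsmul_eq_mul, mul_neg, mul_one]
  congr 1
  omega

/-! ## §2  (D1) Existence of the HNF -/

/-- **(D1) EVERY LATTICE OF `K³` INSIDE `𝒪³` WITH A UNIT FIRST COORDINATE IS AN HNF MODEL.**  For `|ϖ| = exp(−1)`, `g ∈ GL₃(K)` with `M = g·𝒪³ ≤ 𝒪³` and some `w ∈ M`
with `|w₀| = 1`: there are exponents `b, c` and integral `x, y, z` with `M = V·𝒪³`, `V = [[1,0,0],[x,ϖ^b,0],[y,z,ϖ^c]]`.  Here `c` (resp. `b`) is the least exponent with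
`ϖ^c e₂ ∈ M` (resp. `(0, ϖ^b, t) ∈ M` for some `t`) — they exist because `M ⊇ ϖ^j𝒪³` (★ `exists_scaleLattice_pow_stdLattice_le_latt`) — `(1, x, y) = w₀⁻¹·w`, and every
`w′ ∈ M` reduces to `0` along the flag: `w′ − w′₀·(1,x,y) = (0, s, ·)` with `|s| ≤ |ϖ^b|` (minimality of `b`), `s = λϖ^b`, `w′ − w′₀(1,x,y) − λ(0,ϖ^b,z) = (0,0,t)` with
`|t| ≤ |ϖ^c|` (minimality of `c`) — which is ★ `mem_latt_hnf_iff`. [cite: Serre1980Trees, Ch. II §1.1] [cite: Laumon1995, Lemma (5.3.2) p. 136] -/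
theorem exists_latt_eq_latt_hnf {ϖ : K} (hϖ : Valued.v ϖ = WithZero.exp (-1 : ℤ)) (g : GL (Fin 3) K)
    (hle : latt (g : Matrix (Fin 3) (Fin 3) K) ≤ stdLattice K 3)
    (h0 : ∃ w ∈ latt (g : Matrix (Fin 3) (Fin 3) K), Valued.v (w 0) = 1) :
    ∃ (b c : ℕ) (x y z : K), Valued.v x ≤ 1 ∧ Valued.v y ≤ 1 ∧ Valued.v z ≤ 1 ∧
      latt (g : Matrix (Fin 3) (Fin 3) K) = latt (Matrix.of ![![1, 0, 0], ![x, ϖ ^ b, 0], ![y, z, ϖ ^ c]]) := by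
  classical
  set M := latt (g : Matrix (Fin 3) (Fin 3) K) with hM
  have hϖ0 : ϖ ≠ 0 := uniformizer_ne_zero hϖ
  have hint : ∀ w ∈ M, ∀ i, Valued.v (w i) ≤ 1 := fun w hw => mem_stdLattice.1 (hle hw)
  obtain ⟨j, hj⟩ := exists_scaleLattice_pow_stdLattice_le_latt hϖ g
  -- `c`: the least exponent with `ϖ^c e₂ ∈ M`
  have hP2 : ∃ n : ℕ, (Pi.single 2 (ϖ ^ n) : Fin 3 → K) ∈ M := ⟨j, single_pow_mem_of_scaleLattice_le hϖ0 hj 2⟩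
  set c := Nat.find hP2 with hc
  have hc_mem : (Pi.single 2 (ϖ ^ c) : Fin 3 → K) ∈ M := Nat.find_spec hP2
  have hc_min : ∀ n, (Pi.single 2 (ϖ ^ n) : Fin 3 → K) ∈ M → c ≤ n := fun n hn => Nat.find_min' hP2 hn
  -- `b`: the least exponent with `(0, ϖ^b, t) ∈ M` for some `t`
  have hP1 : ∃ n : ℕ, ∃ t : K, (![0, ϖ ^ n, t] : Fin 3 → K) ∈ M := by
    refine ⟨j, 0, ?_⟩
    have h1 := single_pow_mem_of_scaleLattice_le hϖ0 hj 1
    have he : (Pi.single 1 (ϖ ^ j) : Fin 3 → K) = ![0, ϖ ^ j, 0] := by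
      ext i; fin_cases i <;> simp
    rwa [he] at h1
  set b := Nat.find hP1 with hb
  obtain ⟨z, hz_mem⟩ : ∃ t : K, (![0, ϖ ^ b, t] : Fin 3 → K) ∈ M := Nat.find_spec hP1
  have hb_min : ∀ n, (∃ t : K, (![0, ϖ ^ n, t] : Fin 3 → K) ∈ M) → b ≤ n := fun n hn => Nat.find_min' hP1 hn
  -- CLAIM A: the third coordinate of a vector `(0, 0, t) ∈ M` has `|t| ≤ |ϖ^c|`
  have claimA : ∀ t : K, (![0, 0, t] : Fin 3 → K) ∈ M → Valued.v t ≤ Valued.v (ϖ ^ c) := by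
    intro t ht
    by_cases ht0 : t = 0
    · rw [ht0, map_zero]; exact zero_le
    have htle : Valued.v t ≤ 1 := by simpa using hint _ ht 2
    obtain ⟨n, hn⟩ := exists_pow_v_eq hϖ ht0 htle
    -- `ϖ^n e₂ = (ϖ^n t⁻¹) • (0,0,t) ∈ M`
    have hu : Valued.v (ϖ ^ n * t⁻¹) ≤ 1 := by
      rw [map_mul, map_inv₀, ← hn, mul_inv_cancel₀ ((Valuation.ne_zero_iff _).2 ht0)]
    have hmem : (Pi.single 2 (ϖ ^ n) : Fin 3 → K) ∈ M := by
      have heq : (Pi.single 2 (ϖ ^ n) : Fin 3 → K) = (ϖ ^ n * t⁻¹) • (![0, 0, t] : Fin 3 → K) := by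
        ext i; fin_cases i <;> simp [ht0]
      rw [heq]
      exact smul_mem_of_v_le_one M hu ht
    have hcn : c ≤ n := hc_min n hmem
    rw [hn, map_pow, map_pow]
    exact pow_le_pow_right_of_le_one' (by rw [hϖ, ← WithZero.exp_zero, WithZero.exp_le_exp]; omega) hcn
  -- CLAIM B: the second coordinate of a vector `(0, s, t) ∈ M` has `|s| ≤ |ϖ^b|`
  have claimB : ∀ s t : K, (![0, s, t] : Fin 3 → K) ∈ M → Valued.v s ≤ Valued.v (ϖ ^ b) := by
    intro s t hst
    by_cases hs0 : s = 0
    · rw [hs0, map_zero]; exact zero_le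
    have hsle : Valued.v s ≤ 1 := by simpa using hint _ hst 1
    obtain ⟨n, hn⟩ := exists_pow_v_eq hϖ hs0 hsle
    have hu : Valued.v (ϖ ^ n * s⁻¹) ≤ 1 := by
      rw [map_mul, map_inv₀, ← hn, mul_inv_cancel₀ ((Valuation.ne_zero_iff _).2 hs0)]
    have hmem : (![0, ϖ ^ n, (ϖ ^ n * s⁻¹) * t] : Fin 3 → K) ∈ M := by
      have heq : (![0, ϖ ^ n, (ϖ ^ n * s⁻¹) * t] : Fin 3 → K) = (ϖ ^ n * s⁻¹) • (![0, s, t] : Fin 3 → K) := by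
        ext i; fin_cases i <;> simp [hs0]
      rw [heq]
      exact smul_mem_of_v_le_one M hu hst
    have hbn : b ≤ n := hb_min n ⟨_, hmem⟩
    rw [hn, map_pow, map_pow]
    exact pow_le_pow_right_of_le_one' (by rw [hϖ, ← WithZero.exp_zero, WithZero.exp_le_exp]; omega) hbn
  -- the first row `(1, x, y) = w₀⁻¹ • w`
  obtain ⟨w, hw, hw0⟩ := h0
  have hw0ne : w 0 ≠ 0 := fun h => by rw [h, map_zero] at hw0; exact zero_ne_one hw0
  set x : K := w 1 * (w 0)⁻¹ with hx
  set y : K := w 2 * (w 0)⁻¹ with hy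
  have hvinv : Valued.v (w 0)⁻¹ = 1 := by rw [map_inv₀, hw0, inv_one]
  have hv1_mem : (![1, x, y] : Fin 3 → K) ∈ M := by
    have heq : (![1, x, y] : Fin 3 → K) = (w 0)⁻¹ • w := by
      ext i; fin_cases i
      · simp [inv_mul_cancel₀ hw0ne]
      · simp [hx]; ring
      · simp [hy]; ring
    rw [heq]
    exact smul_mem_of_v_le_one M hvinv.le hw
  have hxint : Valued.v x ≤ 1 := by rw [hx, map_mul, hvinv, mul_one]; exact hint w hw 1
  have hyint : Valued.v y ≤ 1 := by rw [hy, map_mul, hvinv, mul_one]; exact hint w hw 2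
  have hzint : Valued.v z ≤ 1 := by simpa using hint _ hz_mem 2
  refine ⟨b, c, x, y, z, hxint, hyint, hzint, le_antisymm ?_ ?_⟩
  · -- `M ≤ V·𝒪³`: reduce along the flag and read ★ `mem_latt_hnf_iff`
    intro w' hw'
    rw [mem_latt_hnf_iff x y z (pow_ne_zero _ hϖ0) (pow_ne_zero _ hϖ0)]
    have h0' : Valued.v (w' 0) ≤ 1 := hint w' hw' 0
    -- first reduction
    have hr1 : (![0, w' 1 - x * w' 0, w' 2 - y * w' 0] : Fin 3 → K) ∈ M := by
      have heq : (![0, w' 1 - x * w' 0, w' 2 - y * w' 0] : Fin 3 → K) = w' - (w' 0) • (![1, x, y] : Fin 3 → K) := by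
        ext i; fin_cases i <;> simp <;> ring
      rw [heq]
      exact M.sub_mem hw' (smul_mem_of_v_le_one M h0' hv1_mem)
    have hs : Valued.v (w' 1 - x * w' 0) ≤ Valued.v (ϖ ^ b) := claimB _ _ hr1
    obtain ⟨lam, hlam, hlam_eq⟩ := exists_mul_of_v_le (pow_ne_zero _ hϖ0) hs
    -- second reduction
    have hr2 : (![0, 0, w' 2 - y * w' 0 - lam * z] : Fin 3 → K) ∈ M := by
      have heq : (![0, 0, w' 2 - y * w' 0 - lam * z] : Fin 3 → K) =
          (![0, w' 1 - x * w' 0, w' 2 - y * w' 0] : Fin 3 → K) - lam • (![0, ϖ ^ b, z] : Fin 3 → K) := by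
        ext i; fin_cases i
        · simp
        · simp
          linear_combination -hlam_eq
        · simp
      rw [heq]
      exact M.sub_mem hr1 (smul_mem_of_v_le_one M hlam hz_mem)
    have ht : Valued.v (w' 2 - y * w' 0 - lam * z) ≤ Valued.v (ϖ ^ c) := claimA _ hr2
    refine ⟨h0', hs, ?_⟩
    have hrew : (w' 2 - y * w' 0) * ϖ ^ b - z * (w' 1 - x * w' 0) = (w' 2 - y * w' 0 - lam * z) * ϖ ^ b := by
      rw [hlam_eq]; ring
    rw [hrew, map_mul, map_mul, mul_comm (Valued.v (ϖ ^ b))]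
    exact mul_le_mul' ht le_rfl
  · -- `V·𝒪³ ≤ M`: the three columns lie in `M`
    have he0 : (Matrix.of ![![1, 0, 0], ![x, ϖ ^ b, 0], ![y, z, ϖ ^ c]]) *ᵥ (Pi.single 0 1) = ![1, x, y] := by
      rw [mulVec_hnf]; ext i; fin_cases i <;> simp
    have he1 : (Matrix.of ![![1, 0, 0], ![x, ϖ ^ b, 0], ![y, z, ϖ ^ c]]) *ᵥ (Pi.single 1 1) = ![0, ϖ ^ b, z] := by
      rw [mulVec_hnf]; ext i; fin_cases i <;> simp
    have he2 : (Matrix.of ![![1, 0, 0], ![x, ϖ ^ b, 0], ![y, z, ϖ ^ c]]) *ᵥ (Pi.single 2 1) = Pi.single 2 (ϖ ^ c) := by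
      rw [mulVec_hnf]; ext i; fin_cases i <;> simp
    refine latt_le_of_columns_three _ _ ?_ ?_ ?_
    · rw [he0]; exact hv1_mem
    · rw [he1]; exact hz_mem
    · rw [he2]; exact hc_mem

/-! ## §3  (D2) Comparison and equality of two HNF models -/

/-- **`V·𝒪³ ≤ V′·𝒪³` IN CLOSED FORM** (`V = [[1,0,0],[x,p,0],[y,z,r]]`, `V′` likewise, `p′, r′ ≠ 0`): the three columns of `V` through ★ `mem_latt_hnf_iff` for `V′` —
`|x − x′| ≤ |p′| ∧ |(y − y′)·p′ − z′·(x − x′)| ≤ |p′·r′| ∧ |p| ≤ |p′| ∧ |z·p′ − z′·p| ≤ |p′·r′| ∧ |r| ≤ |r′|`. [cite: Serre1980Trees, Ch. II §1.1] -/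
theorem latt_hnf_le_latt_hnf_iff (x y z p r x' y' z' : K) {p' r' : K} (hp' : p' ≠ 0) (hr' : r' ≠ 0) :
    latt (Matrix.of ![![1, 0, 0], ![x, p, 0], ![y, z, r]]) ≤ latt (Matrix.of ![![1, 0, 0], ![x', p', 0], ![y', z', r']]) ↔
      Valued.v (x - x') ≤ Valued.v p' ∧ Valued.v ((y - y') * p' - z' * (x - x')) ≤ Valued.v (p' * r') ∧
        Valued.v p ≤ Valued.v p' ∧ Valued.v (z * p' - z' * p) ≤ Valued.v (p' * r') ∧ Valued.v r ≤ Valued.v r' := by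
  have hvr' : 0 < Valued.v r' := (Valuation.pos_iff _).2 hr'
  rw [latt_le_iff_columns]
  have c0 : (Matrix.of ![![1, 0, 0], ![x, p, 0], ![y, z, r]]) *ᵥ (Pi.single 0 1) = ![1, x, y] := by
    rw [mulVec_hnf]; ext i; fin_cases i <;> simp
  have c1 : (Matrix.of ![![1, 0, 0], ![x, p, 0], ![y, z, r]]) *ᵥ (Pi.single 1 1) = ![0, p, z] := by
    rw [mulVec_hnf]; ext i; fin_cases i <;> simp
  have c2 : (Matrix.of ![![1, 0, 0], ![x, p, 0], ![y, z, r]]) *ᵥ (Pi.single 2 1) = ![0, 0, r] := by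
    rw [mulVec_hnf]; ext i; fin_cases i <;> simp
  have m0 : (![1, x, y] : Fin 3 → K) ∈ latt (Matrix.of ![![1, 0, 0], ![x', p', 0], ![y', z', r']]) ↔
      Valued.v (x - x') ≤ Valued.v p' ∧ Valued.v ((y - y') * p' - z' * (x - x')) ≤ Valued.v (p' * r') := by
    rw [mem_latt_hnf_iff x' y' z' hp' hr']
    have e1 : (![1, x, y] : Fin 3 → K) 1 - x' * (![1, x, y] : Fin 3 → K) 0 = x - x' := by simp
    have e2 : ((![1, x, y] : Fin 3 → K) 2 - y' * (![1, x, y] : Fin 3 → K) 0) * p' - z' * ((![1, x, y] : Fin 3 → K) 1 - x' * (![1, x, y] : Fin 3 → K) 0) =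
        (y - y') * p' - z' * (x - x') := by simp
    have e0 : (![1, x, y] : Fin 3 → K) 0 = 1 := rfl
    rw [e2, e1, e0, map_one]
    exact ⟨fun h => ⟨h.2.1, h.2.2⟩, fun h => ⟨le_rfl, h.1, h.2⟩⟩
  have m1 : (![0, p, z] : Fin 3 → K) ∈ latt (Matrix.of ![![1, 0, 0], ![x', p', 0], ![y', z', r']]) ↔
      Valued.v p ≤ Valued.v p' ∧ Valued.v (z * p' - z' * p) ≤ Valued.v (p' * r') := by
    rw [mem_latt_hnf_iff x' y' z' hp' hr']
    have e1 : (![0, p, z] : Fin 3 → K) 1 - x' * (![0, p, z] : Fin 3 → K) 0 = p := by simp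
    have e2 : ((![0, p, z] : Fin 3 → K) 2 - y' * (![0, p, z] : Fin 3 → K) 0) * p' - z' * ((![0, p, z] : Fin 3 → K) 1 - x' * (![0, p, z] : Fin 3 → K) 0) =
        z * p' - z' * p := by simp
    have e0 : (![0, p, z] : Fin 3 → K) 0 = 0 := rfl
    rw [e2, e1, e0, map_zero]
    exact ⟨fun h => ⟨h.2.1, h.2.2⟩, fun h => ⟨zero_le, h.1, h.2⟩⟩
  have m2 : (![0, 0, r] : Fin 3 → K) ∈ latt (Matrix.of ![![1, 0, 0], ![x', p', 0], ![y', z', r']]) ↔ Valued.v r ≤ Valued.v r' := by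
    rw [mem_latt_hnf_iff x' y' z' hp' hr']
    have e1 : (![0, 0, r] : Fin 3 → K) 1 - x' * (![0, 0, r] : Fin 3 → K) 0 = 0 := by simp
    have e2 : ((![0, 0, r] : Fin 3 → K) 2 - y' * (![0, 0, r] : Fin 3 → K) 0) * p' - z' * ((![0, 0, r] : Fin 3 → K) 1 - x' * (![0, 0, r] : Fin 3 → K) 0) =
        r * p' := by simp
    have e0 : (![0, 0, r] : Fin 3 → K) 0 = 0 := rfl
    rw [e2, e1, e0, map_zero, map_mul, map_mul, mul_comm (Valued.v p') (Valued.v r')]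
    have hvp' : 0 < Valued.v p' := (Valuation.pos_iff _).2 hp'
    rw [mul_le_mul_iff_left₀ hvp']
    exact ⟨fun h => h.2.2, fun h => ⟨zero_le, zero_le, h⟩⟩
  constructor
  · intro h
    have h0' := h 0
    have h1' := h 1
    have h2' := h 2
    rw [c0] at h0'
    rw [c1] at h1'
    rw [c2] at h2'
    exact ⟨(m0.1 h0').1, (m0.1 h0').2, (m1.1 h1').1, (m1.1 h1').2, m2.1 h2'⟩
  · rintro ⟨h1, h2, h3, h4, h5⟩
    rw [← latt_le_iff_columns]
    refine latt_le_of_columns_three _ _ ?_ ?_ ?_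
    · rw [c0]; exact m0.2 ⟨h1, h2⟩
    · rw [c1]; exact m1.2 ⟨h3, h4⟩
    · rw [c2]; exact m2.2 h5

/-- **(D2) TWO HNF MODELS WITH THE SAME DIAGONAL SPAN THE SAME LATTICE iff** `|x − x′| ≤ |p|`, `|z − z′| ≤ |r|` and `|(y − y′)·p − z′·(x − x′)| ≤ |p·r|`
(`p, r ≠ 0`): with `p = ϖ^b`, `r = ϖ^c` these say `x ≡ x′ (𝔭^b)`, `z ≡ z′ (𝔭^c)`, `y − y′ ≡ z′·(x − x′)·ϖ^{−b} (𝔭^c)` — the parameter classes of the conductor-square count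
(note the `y`-class is TWISTED by the `x`-representative unless `x = x′`).  (≥) uses `(y′−y)p − z(x′−x) = −[(y−y′)p − z′(x−x′)] + (z−z′)(x−x′)` and the ultrametric inequality.
[cite: Serre1980Trees, Ch. II §1.1] [cite: Kottwitz1986BaseChangeUnits, §1 pp. 240–241] -/
theorem latt_hnf_eq_latt_hnf_iff (x y z x' y' z' : K) {p r : K} (hp : p ≠ 0) (hr : r ≠ 0) :
    latt (Matrix.of ![![1, 0, 0], ![x, p, 0], ![y, z, r]]) = latt (Matrix.of ![![1, 0, 0], ![x', p, 0], ![y', z', r]]) ↔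
      Valued.v (x - x') ≤ Valued.v p ∧ Valued.v (z - z') ≤ Valued.v r ∧
        Valued.v ((y - y') * p - z' * (x - x')) ≤ Valued.v (p * r) := by
  have hvp : 0 < Valued.v p := (Valuation.pos_iff _).2 hp
  have hzz : ∀ u u' : K, Valued.v (u * p - u' * p) ≤ Valued.v (p * r) ↔ Valued.v (u - u') ≤ Valued.v r := by
    intro u u'
    rw [← sub_mul, map_mul, map_mul, mul_comm (Valued.v p) (Valued.v r)]
    exact mul_le_mul_iff_left₀ hvp
  rw [le_antisymm_iff, latt_hnf_le_latt_hnf_iff x y z p r x' y' z' hp hr, latt_hnf_le_latt_hnf_iff x' y' z' p r x y z hp hr, hzz, hzz]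
  constructor
  · rintro ⟨⟨h1, h2, -, h4, -⟩, -⟩
    exact ⟨h1, h4, h2⟩
  · rintro ⟨h1, h4, h2⟩
    have h1' : Valued.v (x' - x) ≤ Valued.v p := by rw [← Valuation.map_neg, neg_sub]; exact h1
    have h4' : Valued.v (z' - z) ≤ Valued.v r := by rw [← Valuation.map_neg, neg_sub]; exact h4
    have h2' : Valued.v ((y' - y) * p - z * (x' - x)) ≤ Valued.v (p * r) := by
      have hrew : (y' - y) * p - z * (x' - x) = -((y - y') * p - z' * (x - x')) + (z - z') * (x - x') := by ring
      rw [hrew]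
      refine (Valuation.map_add _ _ _).trans (max_le ?_ ?_)
      · rw [Valuation.map_neg]; exact h2
      · rw [map_mul, map_mul, mul_comm (Valued.v p) (Valued.v r)]
        exact mul_le_mul' h4 h1
    exact ⟨⟨h1, h2, le_rfl, h4, le_rfl⟩, ⟨h1', h2', le_rfl, h4', le_rfl⟩⟩

/-- `n ↦ |ϖ^n|` is injective for a uniformiser (`|ϖ| = exp(−1)`). [cite: Serre1980Trees, Ch. II §1.1] -/
theorem pow_eq_pow_of_v_eq {ϖ : K} (hϖ : Valued.v ϖ = WithZero.exp (-1 : ℤ)) {m n : ℕ} (h : Valued.v (ϖ ^ m) = Valued.v (ϖ ^ n)) : m = n := by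
  rw [map_pow, map_pow, hϖ, ← WithZero.exp_nsmul, ← WithZero.exp_nsmul] at h
  have := WithZero.exp_injective h
  simp only [nsmul_eq_mul, mul_neg, mul_one, neg_inj, Nat.cast_inj] at this
  exact this

/-- **(D2′) HNF MODELS AT POWERS OF THE UNIFORMISER: EQUALITY DETERMINES THE EXPONENTS**: `V(x,y,z,ϖ^b,ϖ^c)·𝒪³ = V(x′,y′,z′,ϖ^{b′},ϖ^{c′})·𝒪³ → b = b′ ∧ c = c′`
(compare `|ϖ^b| ≤ |ϖ^{b′}|` both ways through `latt_hnf_le_latt_hnf_iff`). [cite: Serre1980Trees, Ch. II §1.1] -/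
theorem exponents_eq_of_latt_hnf_eq {ϖ : K} (hϖ : Valued.v ϖ = WithZero.exp (-1 : ℤ)) {x y z x' y' z' : K} {b c b' c' : ℕ}
    (h : latt (Matrix.of ![![1, 0, 0], ![x, ϖ ^ b, 0], ![y, z, ϖ ^ c]]) = latt (Matrix.of ![![1, 0, 0], ![x', ϖ ^ b', 0], ![y', z', ϖ ^ c']])) :
    b = b' ∧ c = c' := by
  have hϖ0 : ϖ ≠ 0 := uniformizer_ne_zero hϖ
  have h1 := (latt_hnf_le_latt_hnf_iff x y z (ϖ ^ b) (ϖ ^ c) x' y' z' (pow_ne_zero _ hϖ0) (pow_ne_zero _ hϖ0)).1 h.le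
  have h2 := (latt_hnf_le_latt_hnf_iff x' y' z' (ϖ ^ b') (ϖ ^ c') x y z (pow_ne_zero _ hϖ0) (pow_ne_zero _ hϖ0)).1 h.ge
  exact ⟨pow_eq_pow_of_v_eq hϖ (le_antisymm h1.2.2.1 h2.2.2.1), pow_eq_pow_of_v_eq hϖ (le_antisymm h1.2.2.2.2 h2.2.2.2.2)⟩

end Summit.HodgeConjecture.HodgeConjecture.Cruxes.H413.F0P3cDyRamDiagonalStableLatticeHNFExists

end
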